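import Summits.Parity.GeneralizedHardyLittlewood.Theses.LeeYangFibres

/-!
# `ModelHyperbolicity` (stmt-Parity-14110): the guards `2 ≤ u` and `x ≥ x₀(u)` are load-bearing

Negative lemmas for the crux `LeeYangFibres.ModelHyperbolicity` (cdisprove seat), part 1. With
`cell u x j = A_j(x) = #{n ≤ x : x^{1/u} < P⁻(n), Ω(n) = j}`, `cellPoly u x z = Σ_{j ≤ u} A_j(x) z^j`
and `RealRootedAt u x : ∀ z, cellPoly u x z = 0 → z.im = 0`, the crux reads
`∀ u ≥ 2, ∃ x₀, ∀ x ≥ x₀, RealRootedAt u x` (`crux_iff`, by `Iff.rfl`). Proved here: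
* (A2) `2 ≤ u` is load-bearing: at `u = 0` and `u = 1` the cell polynomial is identically zero for
  every `x` (`not_realRootedAt_zero`, `not_realRootedAt_one`, `modelHyperbolicity_false_without_two_le`);
* (A1) the `x₀`-guard is load-bearing: `P_{u,8}(z) = 4z + 2z² + z³ = z((z+1)² + 3)` for EVERY `u ≥ 4`
  (`cellPoly_eight`, `not_realRootedAt_eight`, `modelHyperbolicity_false_without_largeX`);
* tools reused by part 2 (`ModelHyperbolicityUniformFalse`): below `2^u` the rough cells are the
  Landau cells `lset x j = {2 ≤ n ≤ x : Ω(n) = j}` (`cell_eq_card_lset`), `2^{Ω(n)} ≤ n`,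
  `3^{Ω(n)} ≤ n` for odd `n`, and small cells are evaluated by the `Nat.primeFactorsList_ofNat`
  simproc. [folklore]
-/

namespace Summit.Parity.GeneralizedHardyLittlewood.Theorems.ModelHyperbolicity.Negative

open Summit.Parity.GeneralizedHardyLittlewood.Theses.LeeYangFibres
open Finset Polynomial
open scoped Classical

/-! ## §0 The crux, factored -/

/-- The rough-integer cell `A_j(x)` at roughness `u`: the number of `n ≤ x` all of whose prime
factors exceed `x^{1/u}` and with exactly `j` prime factors counted with multiplicity. -/
noncomputable def cell (u x j : ℕ) : ℕ :=
  ((Finset.Icc 1 x).filter (fun n => (x : ℝ) ^ ((1 : ℝ) / u) < (Nat.minFac n : ℝ) ∧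
    ArithmeticFunction.cardFactors n = j)).card

/-- The cell polynomial `P_{u,x}(z) = Σ_{j ≤ u} A_j(x) z^j`. -/
noncomputable def cellPoly (u x : ℕ) (z : ℂ) : ℂ :=
  ∑ j ∈ Finset.range (u + 1), (cell u x j : ℂ) * z ^ j

/-- "`P_{u,x}` has only real zeros". -/
def RealRootedAt (u x : ℕ) : Prop := ∀ z : ℂ, cellPoly u x z = 0 → z.im = 0

/-- The crux, verbatim, in the factored notation (definitional). -/
theorem crux_iff : ModelHyperbolicity ↔ ∀ u : ℕ, 2 ≤ u → ∃ x₀ : ℕ, ∀ x : ℕ, x₀ ≤ x → RealRootedAt u x :=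
  Iff.rfl

/-! ## §1 Elementary lemmas on the threshold `x^{1/u}` and on `Ω` -/

/-- If `x < 2^u` (and `u > 0`) the roughness threshold is below `2`: every `n ≥ 2` is `x^{1/u}`-rough. -/
theorem threshold_lt_two {x u : ℕ} (h : x < 2 ^ u) (hu : 0 < u) : (x : ℝ) ^ ((1 : ℝ) / u) < 2 := by
  rw [one_div, Real.rpow_inv_lt_iff_of_pos (Nat.cast_nonneg _) (by norm_num) (Nat.cast_pos.mpr hu),
    Real.rpow_natCast]
  exact_mod_cast h

/-- The roughness threshold is at least `1` once `x ≥ 1`. -/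
theorem one_le_threshold {x : ℕ} (u : ℕ) (hx : 1 ≤ x) : (1 : ℝ) ≤ (x : ℝ) ^ ((1 : ℝ) / u) :=
  Real.one_le_rpow (by exact_mod_cast hx) (by positivity)

/-- Below `2^u` the cell predicate `x^{1/u} < P⁻(n)` just says `n ≥ 2`. -/
theorem threshold_lt_minFac_iff {x u n : ℕ} (hx : 1 ≤ x) (h : x < 2 ^ u) (hu : 0 < u) (hn : 1 ≤ n) :
    (x : ℝ) ^ ((1 : ℝ) / u) < (Nat.minFac n : ℝ) ↔ 2 ≤ n := by
  constructor
  · intro hlt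
    by_contra hn2
    have hn1 : n = 1 := by omega
    subst hn1
    rw [Nat.minFac_one, Nat.cast_one] at hlt
    exact absurd (one_le_threshold u hx) (not_le.mpr hlt)
  · intro hn2
    have hp : (Nat.minFac n).Prime := Nat.minFac_prime (by omega)
    calc (x : ℝ) ^ ((1 : ℝ) / u) < 2 := threshold_lt_two h hu
      _ ≤ (Nat.minFac n : ℝ) := by exact_mod_cast hp.two_le

/-- `2^{Ω(n)} ≤ n` for `n ≠ 0`. -/
theorem two_pow_cardFactors_le {n : ℕ} (hn : n ≠ 0) : 2 ^ ArithmeticFunction.cardFactors n ≤ n := by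
  rw [ArithmeticFunction.cardFactors_apply]
  conv_rhs => rw [← Nat.prod_primeFactorsList hn]
  exact List.pow_card_le_prod _ _ fun p hp => (Nat.prime_of_mem_primeFactorsList hp).two_le

/-- `3^{Ω(n)} ≤ n` for odd `n`. -/
theorem three_pow_cardFactors_le_of_odd {n : ℕ} (hn : Odd n) :
    3 ^ ArithmeticFunction.cardFactors n ≤ n := by
  have hn0 : n ≠ 0 := by rintro rfl; exact (Nat.not_odd_zero hn).elim
  rw [ArithmeticFunction.cardFactors_apply]
  conv_rhs => rw [← Nat.prod_primeFactorsList hn0]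
  refine List.pow_card_le_prod _ _ fun p hp => ?_
  have hpp : p.Prime := Nat.prime_of_mem_primeFactorsList hp
  have hpn : p ∣ n := Nat.dvd_of_mem_primeFactorsList hp
  have hp2 : p ≠ 2 := by
    rintro rfl
    exact (Nat.not_even_iff_odd.mpr hn) (even_iff_two_dvd.mpr hpn)
  have := hpp.two_le
  omega

/-- A cell above the dyadic ceiling is empty: if `x < 2^j` then `A_j(x) = 0` (any `n` with `Ω(n) = j`
has `n ≥ 2^j > x`). -/
theorem cell_eq_zero_of_lt {u x j : ℕ} (h : x < 2 ^ j) : cell u x j = 0 := by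
  unfold cell
  rw [Finset.card_eq_zero, Finset.filter_eq_empty_iff]
  rintro n hn ⟨-, hj⟩
  rw [Finset.mem_Icc] at hn
  have := two_pow_cardFactors_le (n := n) (by omega)
  rw [hj] at this
  omega

/-- The Landau cell `#{2 ≤ n ≤ x : Ω(n) = j}` (no roughness condition). -/
def lset (x j : ℕ) : Finset ℕ := (Finset.Icc 1 x).filter (fun n => 2 ≤ n ∧ ArithmeticFunction.cardFactors n = j)

/-- Below `2^u` the rough cells ARE the Landau cells. -/
theorem cell_eq_card_lset {x u : ℕ} (hx : 1 ≤ x) (h : x < 2 ^ u) (hu : 0 < u) (j : ℕ) :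
    cell u x j = (lset x j).card := by
  unfold cell lset
  congr 1
  refine Finset.filter_congr fun n hn => ?_
  rw [Finset.mem_Icc] at hn
  rw [threshold_lt_minFac_iff hx h hu hn.1]

/-- A Landau cell above the dyadic ceiling is empty. -/
theorem lset_eq_empty_of_lt {x j : ℕ} (h : x < 2 ^ j) : lset x j = ∅ := by
  unfold lset
  rw [Finset.filter_eq_empty_iff]
  rintro n hn ⟨-, hj⟩
  rw [Finset.mem_Icc] at hn
  have := two_pow_cardFactors_le (n := n) (by omega)
  rw [hj] at this
  omega

/-! ## §A Load-bearing hypotheses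

(A2) `2 ≤ u` cannot be dropped: at `u = 1` (and `u = 0`) the cell polynomial vanishes identically for
every `x`, so `z = i` is a zero.  (A1) "for all large `x`" cannot be replaced by "for all `x ≥ 1`":
at `x = 8` the polynomial is `4z + 2z² + z³ = z((z+1)² + 3)` for EVERY `u ≥ 4`. -/

/-- At `u = 1` every cell is empty: `x < P⁻(n) ≤ n ≤ x` is impossible. -/
theorem cell_one_eq_zero (x j : ℕ) : cell 1 x j = 0 := by
  unfold cell
  rw [Finset.card_eq_zero, Finset.filter_eq_empty_iff]
  rintro n hn ⟨hlt, -⟩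
  rw [Finset.mem_Icc] at hn
  have h1 : (x : ℝ) ^ ((1 : ℝ) / ((1 : ℕ) : ℝ)) = x := by simp
  rw [h1] at hlt
  have : (Nat.minFac n : ℝ) ≤ n := by exact_mod_cast Nat.minFac_le (by omega)
  have : (n : ℝ) ≤ x := by exact_mod_cast hn.2
  linarith

/-- At `u = 1` the cell polynomial is identically zero. -/
theorem cellPoly_one (x : ℕ) (z : ℂ) : cellPoly 1 x z = 0 := by
  unfold cellPoly
  simp [cell_one_eq_zero]

/-- The crux with `u = 1` admitted is false. -/
def ModelHyperbolicityWithoutTwoLe : Prop :=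
  ∀ u : ℕ, ∃ x₀ : ℕ, ∀ x : ℕ, x₀ ≤ x → RealRootedAt u x

/-- (A2) `2 ≤ u` is load-bearing: with `u = 1` admitted the statement is false (`z = i`). -/
theorem modelHyperbolicity_false_without_two_le : ¬ ModelHyperbolicityWithoutTwoLe := by
  intro h
  obtain ⟨x₀, hx₀⟩ := h 1
  have := hx₀ x₀ le_rfl Complex.I (cellPoly_one x₀ _)
  simp at this

/-- At `u = 0` Lean reads `x ^ (1/0) = x ^ 0 = 1`, the only cell in `range 1` is `j = 0`, and
`Ω(n) = 0` forces `n = 1` with `P⁻(1) = 1`: again the zero polynomial. -/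
theorem cellPoly_zero (x : ℕ) (z : ℂ) : cellPoly 0 x z = 0 := by
  unfold cellPoly cell
  simp only [zero_add, Finset.range_one, Finset.sum_singleton, pow_zero, mul_one, Nat.cast_eq_zero,
    Finset.card_eq_zero, Finset.filter_eq_empty_iff]
  rintro n hn ⟨hlt, hj⟩
  rw [Finset.mem_Icc] at hn
  have hn1 : n = 1 := by
    rcases ArithmeticFunction.cardFactors_eq_zero_iff_eq_zero_or_one.mp hj with h | h <;> omega
  subst hn1
  simp at hlt

/-- `u = 0` fails at every `x` (zero polynomial). -/
theorem not_realRootedAt_zero (x : ℕ) : ¬ RealRootedAt 0 x := fun h => by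
  simpa using h Complex.I (cellPoly_zero x _)

/-- `u = 1` fails at every `x` (zero polynomial). -/
theorem not_realRootedAt_one (x : ℕ) : ¬ RealRootedAt 1 x := fun h => by
  simpa using h Complex.I (cellPoly_one x _)


/-! ### (A1) the `x₀`-guard is load-bearing: `x = 8` fails for every `u ≥ 4` -/

/-- No `n ≥ 2` has `Ω(n) = 0`. -/
theorem lset_zero (x : ℕ) : lset x 0 = ∅ := by
  unfold lset
  rw [Finset.filter_eq_empty_iff]
  rintro n - ⟨hn2, hΩ⟩
  rcases ArithmeticFunction.cardFactors_eq_zero_iff_eq_zero_or_one.mp hΩ with h | h <;> omega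

/-- The Landau cells at `x = 8`: `{2,3,5,7}`, `{4,6}`, `{8}`. -/
theorem card_lset_eight :
    (lset 8 1).card = 4 ∧ (lset 8 2).card = 2 ∧ (lset 8 3).card = 1 := by
  refine ⟨?_, ?_, ?_⟩ <;>
  · unfold lset
    rw [Finset.card_filter]
    simp [Finset.sum_Icc_succ_top, ArithmeticFunction.cardFactors_apply, Nat.primeFactorsList_ofNat]

/-- For every `u ≥ 4`: `P_{u,8}(z) = 4z + 2z² + z³`. -/
theorem cellPoly_eight (u : ℕ) (hu : 4 ≤ u) (z : ℂ) : cellPoly u 8 z = 4 * z + 2 * z ^ 2 + z ^ 3 := by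
  unfold cellPoly
  have hx : (8 : ℕ) < 2 ^ u := lt_of_lt_of_le (by norm_num) (Nat.pow_le_pow_right (by norm_num) hu)
  have hcell : ∀ j, cell u 8 j = (lset 8 j).card := cell_eq_card_lset (by norm_num) hx (by omega)
  simp_rw [hcell]
  obtain ⟨h1, h2, h3⟩ := card_lset_eight
  rw [← Finset.sum_subset (s₁ := ({1, 2, 3} : Finset ℕ))]
  · simp [Finset.sum_insert, h1, h2, h3]
    ring
  · intro j hj
    simp only [Finset.mem_insert, Finset.mem_singleton] at hj
    simp only [Finset.mem_range]
    omega
  · intro j _ hj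
    simp only [Finset.mem_insert, Finset.mem_singleton, not_or] at hj
    obtain ⟨hj1, hj2, hj3⟩ := hj
    rcases Nat.eq_zero_or_pos j with rfl | hj0
    · simp [lset_zero]
    · have hj4 : 4 ≤ j := by omega
      have : (8 : ℕ) < 2 ^ j := lt_of_lt_of_le (by norm_num) (Nat.pow_le_pow_right (by norm_num) hj4)
      simp [lset_eq_empty_of_lt this]

/-- (A1) For every `u ≥ 4`, `P_{u,8}` has the non-real zero pair `-1 ± i√3`. -/
theorem not_realRootedAt_eight (u : ℕ) (hu : 4 ≤ u) : ¬ RealRootedAt u 8 := by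
  intro h
  obtain ⟨z, hz⟩ : ∃ z : ℂ, z ^ 2 + 2 * z + 4 = 0 := by
    obtain ⟨z, hz⟩ := IsAlgClosed.exists_root (C 1 * X ^ 2 + C 2 * X + C 4 : ℂ[X])
      (by rw [Polynomial.degree_quadratic (by norm_num)]; norm_num)
    exact ⟨z, by simpa [IsRoot] using hz⟩
  have him : z.im = 0 := h z (by rw [cellPoly_eight u hu]; linear_combination z * hz)
  have hre : (z.re : ℂ) = z := Complex.ext rfl (by simp [him])
  rw [← hre] at hz
  norm_cast at hz
  nlinarith [sq_nonneg (z.re + 1)]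

/-- The crux with the `x₀`-guard dropped (all `x ≥ 1`) — false. -/
def ModelHyperbolicityWithoutLargeX : Prop :=
  ∀ u : ℕ, 2 ≤ u → ∀ x : ℕ, 1 ≤ x → RealRootedAt u x

/-- (A1) the `x₀`-guard is load-bearing. -/
theorem modelHyperbolicity_false_without_largeX : ¬ ModelHyperbolicityWithoutLargeX :=
  fun h => not_realRootedAt_eight 4 le_rfl (h 4 (by norm_num) 8 (by norm_num))

end Summit.Parity.GeneralizedHardyLittlewood.Theorems.ModelHyperbolicity.Negative
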